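import Mathlib
import HarnessLib
import HarnessLib.Audit

/-!
# Marica–Schönheim for subcube counts — hp-7 gen 65

Support file for crux `stmt-CriticalPhenomena-4575` (route `PercNearOneGluingNoHeavy`), hull-port seat `prim-hp-7` (generation 65);
`--supports stmt-CriticalPhenomena-4575`.  No `sorry`, theorems only.  Memo: `run/shared/lean/prim/prim-hp-7/FROM-prim-hp-7-g65-REDUCTIONS.md` §0 (SUBCUBE FORM).

For a set family `𝒜` and a set of coordinates `R`, an `R`-SUBCUBE of `𝒜` is a base `q` (disjoint from `R`) with `q ∪ u ∈ 𝒜` for every `u ⊆ R`;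
their number is `f_R(𝒜)`.  **Theorem** (`card_cubes_le_card_cubes_diffs`): `f_R(𝒜 \\ 𝒜) ≥ f_R(𝒜)` for every `R` — the difference family contains at
least as many subcubes of every type as `𝒜` (`R = ∅` is the Marica–Schönheim inequality itself, `|R| = 1` the edge count of the companion file `…MSEdges`).
Proof ("fibre trick"): for bases `q, q'` of `R`-subcubes of `𝒜` and `u ⊆ R`, `(q \ q') ∪ u = (q ∪ u) \ q'` is a difference, so `q \ q'` is the base of an
`R`-subcube of `𝒜 \\ 𝒜`; hence (bases of `𝒜`) `\\` (bases of `𝒜`) ⊆ bases of `𝒜 \\ 𝒜`, and Marica–Schönheim (`Finset.card_le_card_diffs`) applied to the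
family of bases finishes.  This is the monochromatic case `B = ∅` of the conjectured subcube form (H2-cube) of generation 65
(`f_R(A \\ A ∪ B \\ B ∪ A ⊼ B ∪ A ⊻ B) ≥ f_R(A ∪ B)` for disjoint `A, B`; exhaustive for ground sets of size ≤ 4), the two-axis case of Conjecture HEX-MS in Δ-strength.
-/

namespace Summit.CriticalPhenomena.PercolationContinuityZ3.Theorems

namespace GeneratedDonors

open Finset FinsetFamily

variable {α : Type*} [DecidableEq α]

/-- Bases of `R`-subcubes of `𝒜`: members `q` avoiding `R` with `q ∪ u ∈ 𝒜` for all `u ⊆ R`. -/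
theorem mem_filter_cubeBase {𝒜 : Finset (Finset α)} {R q : Finset α} :
    q ∈ 𝒜.filter (fun q => (∀ i ∈ R, i ∉ q) ∧ ∀ u ∈ R.powerset, q ∪ u ∈ 𝒜) ↔
      q ∈ 𝒜 ∧ (∀ i ∈ R, i ∉ q) ∧ ∀ u ∈ R.powerset, q ∪ u ∈ 𝒜 := by
  rw [mem_filter]

/-- **Fibre trick for subcubes**: if `q, q'` are bases of `R`-subcubes of `𝒜` then `q \ q'` is the base of an `R`-subcube of `𝒜 \\ 𝒜`,
because `(q \ q') ∪ u = (q ∪ u) \ q'` for `u ⊆ R` (as `q'` avoids `R`). -/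
theorem diffs_cubeBase_subset_cubeBase_diffs (𝒜 : Finset (Finset α)) (R : Finset α) :
    (𝒜.filter fun q => (∀ i ∈ R, i ∉ q) ∧ ∀ u ∈ R.powerset, q ∪ u ∈ 𝒜) \\
        (𝒜.filter fun q => (∀ i ∈ R, i ∉ q) ∧ ∀ u ∈ R.powerset, q ∪ u ∈ 𝒜)
      ⊆ (𝒜 \\ 𝒜).filter fun q => (∀ i ∈ R, i ∉ q) ∧ ∀ u ∈ R.powerset, q ∪ u ∈ 𝒜 \\ 𝒜 := by
  intro d hd
  rw [mem_diffs] at hd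
  obtain ⟨q, hq, q', hq', rfl⟩ := hd
  rw [mem_filter] at hq hq'
  obtain ⟨hqA, hqR, hqcube⟩ := hq
  obtain ⟨hq'A, hq'R, -⟩ := hq'
  rw [mem_filter]
  refine ⟨mem_diffs.mpr ⟨q, hqA, q', hq'A, rfl⟩, fun i hi h => hqR i hi (mem_sdiff.mp h).1, fun u hu => ?_⟩
  have huR : u ⊆ R := mem_powerset.mp hu
  have key : q \ q' ∪ u = (q ∪ u) \ q' := by
    ext i
    simp only [mem_union, mem_sdiff]
    constructor
    · rintro (⟨hiq, hiq'⟩ | hiu)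
      · exact ⟨Or.inl hiq, hiq'⟩
      · exact ⟨Or.inr hiu, hq'R i (huR hiu)⟩
    · rintro ⟨hiq | hiu, hiq'⟩
      · exact Or.inl ⟨hiq, hiq'⟩
      · exact Or.inr hiu
  rw [key]
  exact mem_diffs.mpr ⟨q ∪ u, hqcube u hu, q', hq'A, rfl⟩

/-- ★ **Marica–Schönheim for subcube counts**: for every set of coordinates `R`, the difference family `𝒜 \\ 𝒜` has at least as many
`R`-subcubes as `𝒜` (`f_R(𝒜 \\ 𝒜) ≥ f_R(𝒜)`; `R = ∅` is Marica–Schönheim). -/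
theorem card_cubes_le_card_cubes_diffs (𝒜 : Finset (Finset α)) (R : Finset α) :
    #(𝒜.filter fun q => (∀ i ∈ R, i ∉ q) ∧ ∀ u ∈ R.powerset, q ∪ u ∈ 𝒜)
      ≤ #((𝒜 \\ 𝒜).filter fun q => (∀ i ∈ R, i ∉ q) ∧ ∀ u ∈ R.powerset, q ∪ u ∈ 𝒜 \\ 𝒜) :=
  (card_le_card_diffs _).trans (card_le_card (diffs_cubeBase_subset_cubeBase_diffs 𝒜 R))

/-- **Fibre trick for meets** (two colours): if `q` is the base of an `R`-subcube of `𝒜` and `q'` of one of `ℬ`, then `q ∩ q'` is the base of an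
`R`-subcube of `𝒜 ⊼ ℬ`, because `(q ∩ q') ∪ u = (q ∪ u) ∩ (q' ∪ u)`.  (With the sups version below and `diffs_cubeBase_subset_cubeBase_diffs` this embeds
`T(𝒜_R, ℬ_R)` into the `R`-subcubes of `T(𝒜, ℬ) = 𝒜 \\ 𝒜 ∪ ℬ \\ ℬ ∪ 𝒜 ⊼ ℬ ∪ 𝒜 ⊻ ℬ` — the monochromatic part of the conjectured (H2-cube).) -/
theorem infs_cubeBase_subset_cubeBase_infs (𝒜 ℬ : Finset (Finset α)) (R : Finset α) :
    (𝒜.filter fun q => (∀ i ∈ R, i ∉ q) ∧ ∀ u ∈ R.powerset, q ∪ u ∈ 𝒜) ⊼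
        (ℬ.filter fun q => (∀ i ∈ R, i ∉ q) ∧ ∀ u ∈ R.powerset, q ∪ u ∈ ℬ)
      ⊆ (𝒜 ⊼ ℬ).filter fun q => (∀ i ∈ R, i ∉ q) ∧ ∀ u ∈ R.powerset, q ∪ u ∈ 𝒜 ⊼ ℬ := by
  intro d hd
  rw [mem_infs] at hd
  obtain ⟨q, hq, q', hq', rfl⟩ := hd
  rw [mem_filter] at hq hq'
  obtain ⟨hqA, hqR, hqcube⟩ := hq
  obtain ⟨hq'B, hq'R, hq'cube⟩ := hq'
  rw [mem_filter]
  refine ⟨mem_infs.mpr ⟨q, hqA, q', hq'B, rfl⟩, fun i hi h => hqR i hi ?_, fun u hu => ?_⟩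
  · rw [inf_eq_inter, mem_inter] at h
    exact h.1
  · have key : q ⊓ q' ∪ u = (q ∪ u) ⊓ (q' ∪ u) := by
      ext i
      simp only [inf_eq_inter, mem_union, mem_inter]
      tauto
    rw [key]
    exact mem_infs.mpr ⟨q ∪ u, hqcube u hu, q' ∪ u, hq'cube u hu, rfl⟩

/-- **Fibre trick for joins** (two colours): bases of `R`-subcubes of `𝒜` and `ℬ` join to bases of `R`-subcubes of `𝒜 ⊻ ℬ`,
because `(q ∪ q') ∪ u = (q ∪ u) ∪ (q' ∪ u)`. -/
theorem sups_cubeBase_subset_cubeBase_sups (𝒜 ℬ : Finset (Finset α)) (R : Finset α) :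
    (𝒜.filter fun q => (∀ i ∈ R, i ∉ q) ∧ ∀ u ∈ R.powerset, q ∪ u ∈ 𝒜) ⊻
        (ℬ.filter fun q => (∀ i ∈ R, i ∉ q) ∧ ∀ u ∈ R.powerset, q ∪ u ∈ ℬ)
      ⊆ (𝒜 ⊻ ℬ).filter fun q => (∀ i ∈ R, i ∉ q) ∧ ∀ u ∈ R.powerset, q ∪ u ∈ 𝒜 ⊻ ℬ := by
  intro d hd
  rw [mem_sups] at hd
  obtain ⟨q, hq, q', hq', rfl⟩ := hd
  rw [mem_filter] at hq hq'
  obtain ⟨hqA, hqR, hqcube⟩ := hq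
  obtain ⟨hq'B, hq'R, hq'cube⟩ := hq'
  rw [mem_filter]
  refine ⟨mem_sups.mpr ⟨q, hqA, q', hq'B, rfl⟩, fun i hi h => ?_, fun u hu => ?_⟩
  · rw [sup_eq_union, mem_union] at h
    exact h.elim (hqR i hi) (hq'R i hi)
  · have key : q ⊔ q' ∪ u = (q ∪ u) ⊔ (q' ∪ u) := by
      ext i
      simp only [sup_eq_union, mem_union]
      tauto
    rw [key]
    exact mem_sups.mpr ⟨q ∪ u, hqcube u hu, q' ∪ u, hq'cube u hu, rfl⟩

end GeneratedDonors

end Summit.CriticalPhenomena.PercolationContinuityZ3.Theorems
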